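import Literature.Geometry.Riemannian.GurskyViaclovskyClosednessChartEquation
import HarnessLib

/-!
# Gursky–Viaclovsky closedness: the chart operator is smooth in the point and the `2`-jet

Support file (everything PROVED; no definition, no named fact) for the named fact
`Literature.Geometry.Riemannian.gurskyViaclovsky_pathClosed_weighted_four`. Gilbarg–Trudinger's
Evans–Krylov theorem (Thm. 17.14) is stated for `F ∈ C²(Γ)`, `Γ = Ω × ℝ × ℝⁿ × ℝ^{n×n}`. For the
chart form of the background equation (`GurskyViaclovskyClosednessChartEquation.lean`),
`F(y, z, p, r) = chartOperator G t (W y) y p r − q̃(y)e^{4z}`, this file supplies the regularity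
in `(y, p, r)`: for smooth metric components `G` on an open `V ⊆ E` (`MetricCoord.IsMetricOn`),

* `contDiffOn_coordHess`, `contDiffOn_gvForm` — `(y, p, r) ↦ r − p ∘ Γ_y` and Gursky–Viaclovsky's
  form `𝒜^t(y, p, r)` are `C^∞` on `V × (E →L ℝ) × (E →L E →L ℝ)` (Christoffel symbols, Ricci
  and scalar curvature of the components and `G⁻¹` are `C^∞` on `V`: `contDiffOn_chrAt`,
  `contDiffOn_ricAt`, `contDiffOn_scalAt`, `contDiffOn_sharpAt`; the jet enters polynomially);
* `contDiffOn_chartOperator` — so is `(y, p, r) ↦ chartOperator G t (W y) y p r` for `W` smooth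
  on `V` (metric trace and square norm through `traceCLM`).

## References

* D. Gilbarg, N. S. Trudinger, *Elliptic Partial Differential Equations of Second Order* (2001),
  §17.4, Thm. 17.14 (hypothesis `F ∈ C²(Γ)`). [GilbargTrudinger2001]
* M. J. Gursky, J. A. Viaclovsky, J. Differential Geom. 63 (2003) 131–154, §1. [GurskyViaclovsky2003]
-/

noncomputable section

set_option maxSynthPendingDepth 3

open scoped ContDiff Topology
open Set Function

namespace Literature.Geometry.Riemannian.GurskyViaclovskyPath

open Literature.Geometry.Lorentzian
open Literature.Geometry.Lorentzian.MetricCoord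

section Smoothness

variable {E : Type*} [NormedAddCommGroup E] [NormedSpace ℝ E] [FiniteDimensional ℝ E]
  [CompleteSpace E] {G : E → E →L[ℝ] E →L[ℝ] ℝ} {V : Set E}

/-- The jet space `E × E* × Bil(E)` and the domain `V × E* × Bil(E)`. -/
local notation "Jet" E => E × (E →L[ℝ] ℝ) × (E →L[ℝ] E →L[ℝ] ℝ)

omit [FiniteDimensional ℝ E] [CompleteSpace E] in
/-- `Prod.fst` maps the domain into `V`. [folklore] -/
theorem mapsTo_fst_jet (V : Set E) :
    MapsTo (Prod.fst : (Jet E) → E) ((Prod.fst : (Jet E) → E) ⁻¹' V) V := fun _ hx ↦ hx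

omit [FiniteDimensional ℝ E] in
/-- **The coordinate Hessian of a jet is smooth in `(y, p, r)`.** [folklore] -/
theorem contDiffOn_coordHess (hG : IsMetricOn G V) :
    ContDiffOn ℝ ∞ (fun x : Jet E ↦ coordHess G x.1 x.2.1 x.2.2)
      ((Prod.fst : (Jet E) → E) ⁻¹' V) := by
  have h1 : ContDiffOn ℝ ∞ (fun x : Jet E ↦ x.2.2) ((Prod.fst : (Jet E) → E) ⁻¹' V) :=
    contDiff_snd.snd.contDiffOn
  set cL : (E →L[ℝ] ℝ) →L[ℝ] (E →L[ℝ] E) →L[ℝ] (E →L[ℝ] ℝ) := ContinuousLinearMap.compL ℝ E E ℝ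
    with hcL
  have h2 : ContDiffOn ℝ ∞ (fun x : Jet E ↦ cL x.2.1) ((Prod.fst : (Jet E) → E) ⁻¹' V) :=
    (cL.contDiff.comp contDiff_snd.fst).contDiffOn
  have h3 : ContDiffOn ℝ ∞ (fun x : Jet E ↦ chrAt G x.1) ((Prod.fst : (Jet E) → E) ⁻¹' V) :=
    hG.contDiffOn_chrAt.comp contDiffOn_fst (mapsTo_fst_jet V)
  exact h1.sub (h2.clm_comp h3)

/-- **The metric trace of a smooth jet-dependent field of bilinear forms is smooth.** [folklore] -/
theorem contDiffOn_mtrAt_jet (hG : IsMetricOn G V) {β : (Jet E) → E →L[ℝ] E →L[ℝ] ℝ}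
    (hβ : ContDiffOn ℝ ∞ β ((Prod.fst : (Jet E) → E) ⁻¹' V)) :
    ContDiffOn ℝ ∞ (fun x : Jet E ↦ mtrAt G x.1 (β x)) ((Prod.fst : (Jet E) → E) ⁻¹' V) := by
  simp only [mtrAt_eq_traceCLM]
  have hS : ContDiffOn ℝ ∞ (fun x : Jet E ↦ sharpAt G x.1) ((Prod.fst : (Jet E) → E) ⁻¹' V) :=
    hG.contDiffOn_sharpAt.comp contDiffOn_fst (mapsTo_fst_jet V)
  exact (traceCLM E).contDiff.comp_contDiffOn (hS.clm_comp hβ)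

/-- **The metric square norm of a smooth jet-dependent field of bilinear forms is smooth.**
[folklore] -/
theorem contDiffOn_normSqAt_jet (hG : IsMetricOn G V) {β : (Jet E) → E →L[ℝ] E →L[ℝ] ℝ}
    (hβ : ContDiffOn ℝ ∞ β ((Prod.fst : (Jet E) → E) ⁻¹' V)) :
    ContDiffOn ℝ ∞ (fun x : Jet E ↦ normSqAt G x.1 (β x)) ((Prod.fst : (Jet E) → E) ⁻¹' V) := by
  simp only [normSqAt_eq_traceCLM]
  have hS : ContDiffOn ℝ ∞ (fun x : Jet E ↦ sharpAt G x.1) ((Prod.fst : (Jet E) → E) ⁻¹' V) :=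
    hG.contDiffOn_sharpAt.comp contDiffOn_fst (mapsTo_fst_jet V)
  set fl : (E →L[ℝ] E →L[ℝ] ℝ) ≃ₗᵢ[ℝ] (E →L[ℝ] E →L[ℝ] ℝ) := ContinuousLinearMap.flipₗᵢ ℝ E E ℝ
    with hfl
  have hflip : ContDiffOn ℝ ∞ (fun x : Jet E ↦ fl (β x)) ((Prod.fst : (Jet E) → E) ⁻¹' V) :=
    fl.contDiff.comp_contDiffOn hβ
  exact (traceCLM E).contDiff.comp_contDiffOn
    ((hS.clm_comp hβ).clm_comp (hS.clm_comp hflip))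

/-- **Gursky–Viaclovsky's form `𝒜^t(y, p, r)` is smooth in `(y, p, r)`** on
`V × E* × Bil(E)`. [cite: GurskyViaclovsky2003, §1 (change1)] -/
theorem contDiffOn_gvForm (hG : IsMetricOn G V) (t : ℝ) :
    ContDiffOn ℝ ∞ (fun x : Jet E ↦ gvForm G t x.1 x.2.1 x.2.2)
      ((Prod.fst : (Jet E) → E) ⁻¹' V) := by
  have hGx : ContDiffOn ℝ ∞ (fun x : Jet E ↦ G x.1) ((Prod.fst : (Jet E) → E) ⁻¹' V) :=
    hG.contDiffOn.comp contDiffOn_fst (mapsTo_fst_jet V)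
  have hRic : ContDiffOn ℝ ∞ (fun x : Jet E ↦ ricAt G x.1) ((Prod.fst : (Jet E) → E) ⁻¹' V) :=
    hG.contDiffOn_ricAt.comp contDiffOn_fst (mapsTo_fst_jet V)
  have hScal : ContDiffOn ℝ ∞ (fun x : Jet E ↦ scalAt G x.1) ((Prod.fst : (Jet E) → E) ⁻¹' V) :=
    hG.contDiffOn_scalAt.comp contDiffOn_fst (mapsTo_fst_jet V)
  have hS : ContDiffOn ℝ ∞ (fun x : Jet E ↦ sharpAt G x.1) ((Prod.fst : (Jet E) → E) ⁻¹' V) :=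
    hG.contDiffOn_sharpAt.comp contDiffOn_fst (mapsTo_fst_jet V)
  have hp : ContDiffOn ℝ ∞ (fun x : Jet E ↦ x.2.1) ((Prod.fst : (Jet E) → E) ⁻¹' V) :=
    contDiff_snd.fst.contDiffOn
  have hH := contDiffOn_coordHess hG (V := V)
  have htr := contDiffOn_mtrAt_jet hG hH
  -- `p (♯ p)`
  have hsp : ContDiffOn ℝ ∞ (fun x : Jet E ↦ sharpAt G x.1 x.2.1) ((Prod.fst : (Jet E) → E) ⁻¹' V) :=
    hS.clm_apply hp
  have hpsp : ContDiffOn ℝ ∞ (fun x : Jet E ↦ x.2.1 (sharpAt G x.1 x.2.1))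
      ((Prod.fst : (Jet E) → E) ⁻¹' V) := hp.clm_apply hsp
  -- `p ⊗ p`
  have hpp : ContDiffOn ℝ ∞ (fun x : Jet E ↦ (x.2.1).smulRight x.2.1)
      ((Prod.fst : (Jet E) → E) ⁻¹' V) := by
    have hb : ContDiff ℝ ∞ (fun q : (E →L[ℝ] ℝ) × (E →L[ℝ] ℝ) ↦ q.1.smulRight q.2) :=
      (isBoundedBilinearMap_smulRight (𝕜 := ℝ) (E := E) (F := E →L[ℝ] ℝ)).contDiff
    have hq : ContDiff ℝ ∞ (fun x : Jet E ↦ (x.2.1, x.2.1)) := contDiff_snd.fst.prodMk contDiff_snd.fst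
    exact (hb.comp hq).contDiffOn
  have hA1 : ContDiffOn ℝ ∞
      (fun x : Jet E ↦ (1 / 2 : ℝ) • (ricAt G x.1 - (t / 6 * scalAt G x.1) • G x.1))
      ((Prod.fst : (Jet E) → E) ⁻¹' V) :=
    (hRic.sub ((contDiffOn_const.mul hScal).smul hGx)).const_smul (1 / 2 : ℝ)
  have hA2 : ContDiffOn ℝ ∞
      (fun x : Jet E ↦ ((1 - t) / 2 * mtrAt G x.1 (coordHess G x.1 x.2.1 x.2.2)) • G x.1)
      ((Prod.fst : (Jet E) → E) ⁻¹' V) :=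
    (contDiffOn_const.mul htr).smul hGx
  have hA3 : ContDiffOn ℝ ∞
      (fun x : Jet E ↦ ((2 - t) / 2 * x.2.1 (sharpAt G x.1 x.2.1)) • G x.1)
      ((Prod.fst : (Jet E) → E) ⁻¹' V) :=
    (contDiffOn_const.mul hpsp).smul hGx
  have h := (((hA1.add hH).add hA2).add hpp).sub hA3
  exact h.congr fun x _ ↦ rfl

/-- **The chart operator is smooth in `(y, p, r)`** for a smooth Weyl-term coefficient `W` on
`V`. [cite: GilbargTrudinger2001, §17.4 (hypothesis `F ∈ C²(Γ)` of Thm. 17.14)] -/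
theorem contDiffOn_chartOperator (hG : IsMetricOn G V) (t : ℝ) {W : E → ℝ}
    (hW : ContDiffOn ℝ ∞ W V) :
    ContDiffOn ℝ ∞ (fun x : Jet E ↦ chartOperator G t (W x.1) x.1 x.2.1 x.2.2)
      ((Prod.fst : (Jet E) → E) ⁻¹' V) := by
  have hA := contDiffOn_gvForm hG t (V := V)
  have htr := contDiffOn_mtrAt_jet hG hA
  have hns := contDiffOn_normSqAt_jet hG hA
  have hW' : ContDiffOn ℝ ∞ (fun x : Jet E ↦ W x.1) ((Prod.fst : (Jet E) → E) ⁻¹' V) :=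
    hW.comp contDiffOn_fst (mapsTo_fst_jet V)
  exact (contDiffOn_const.mul ((htr.pow 2).sub hns)).sub (contDiffOn_const.mul hW')

end Smoothness

end Literature.Geometry.Riemannian.GurskyViaclovskyPath

end
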